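import Mathlib.Analysis.FunctionalSpaces.SobolevInequality
import Mathlib.MeasureTheory.Measure.Haar.InnerProductSpace
import Mathlib.MeasureTheory.Integral.IntegralEqImproper
import Literature.Analysis.FluidPDE.SobolevWholeSpace
import Literature.Analysis.FluidPDE.RapidDecayLemmas
import HarnessLib

/-!
# Planar Sobolev inequalities with explicit constants (Gagliardo–Nirenberg, Ladyzhenskaya, Nash)

Literature file (topic `Analysis/FluidPDE`), all results proved, no definitions, no named facts.

## Why this file exists

Every planar Sobolev / Ladyzhenskaya / Nash inequality in the tree so far
(`sq_integral_sq_le_nash`, `sq_integral_sq_le_nash_of_integrable`, `PlanarVorticityLpDecay`,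
`PlanarVelocityDecay`, `AxisymShellLadyzhenskaya`, …) carries Mathlib's constant
`C_GNS = lintegralPowLePowLIntegralFDerivConst volume 2`. That constant is NOT a number one can
bound: Mathlib defines it (`SobolevInequality.lean`) as `c · ‖e.symm‖₊ ^ p · (c ^ p)⁻¹` for the
continuous linear equivalence `e := ContinuousLinearEquiv.ofFinrankEq …` between the space and
`Fin n → ℝ`, and `LinearEquiv.ofFinrankEq … := Classical.choice …`
(`Mathlib/LinearAlgebra/Dimension/Free.lean`) — an ARBITRARY linear equivalence. Since
`μ = c • map e.symm volume` forces `c = |det e|⁻¹`, the constant is `|det e|^{p-1} ‖e⁻¹‖^p`, the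
operator norm being taken from the sup norm of `Fin n → ℝ` to the Euclidean norm; in the plane
(`p = 2`), for `e = diag(a, b)` it equals `ab (a⁻² + b⁻²) = a/b + b/a`: `2` for a conformal choice,
unbounded over all choices — so no numeric upper bound on `C_GNS` is provable.
Here the planar inequalities are re-proved from scratch with EXPLICIT constants, in the shapes the
tree's consumers use, so that every downstream bound (e.g. the Burgers-scale ceilings of
`PalasekTowerLundgrenChildSwirlCeiling`) can be made numeric by replacing one lemma name.

## Contents (plane `ℝ² = EuclideanSpace ℝ (Fin 2)`, Lebesgue measure, `e₀, e₁` the standard basis)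

* `two_mul_enorm_le_lintegral_deriv` — the two-sided one-dimensional estimate
  `2 ‖φ(x)‖ ≤ ∫ ‖φ'‖` for `φ ∈ C¹_c(ℝ; F)` (sum of the two one-sided fundamental-theorem bounds).
* `four_mul_lintegral_sq_le` / `four_mul_integral_norm_sq_le` — the **Gagliardo–Nirenberg product
  form** `4 ∫ ‖u‖² ≤ (∫ ‖Du e₀‖) (∫ ‖Du e₁‖)` for `u ∈ C¹_c(ℝ²; F)` (equality for the indicator of
  a square, up to smoothing): the pointwise bound along both coordinate lines and Tonelli.
* `integral_norm_sq_le_quarter` — `∫ ‖u‖² ≤ ¼ (∫ ‖Du‖)²` (vector-valued `u`);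
  `integral_sq_le_eighth` — `∫ u² ≤ ⅛ (∫ ‖Du‖)²` (scalar `u`; `|Du e₀| + |Du e₁| ≤ √2 ‖Du‖`).
  Printed (one-sided pointwise bound): `‖u‖₂ ≤ (∫|D₁u| ∫|D₂u|)^{1/2} ≤ 2^{-1/2} ‖Du‖₁`
  (Gilbarg–Trudinger (7.27)–(7.28), `n = 2`); the two-sided bound halves each factor.
* `integral_pow_four_le_half` — **Ladyzhenskaya's inequality** `∫ f⁴ ≤ ½ (∫ f²) (∫ ‖Df‖²)`,
  `f ∈ C¹_c(ℝ²)` (printed with constant `2`: Ladyzhenskaya 1959, Seregin 2014 Lemma 5.2);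
  `integral_pow_four_le_half_of_integrable` — the same for every `C¹` function with `f ∈ L²`,
  `Df ∈ L²`, INCLUDING the conclusion `f ∈ L⁴` (truncation + Fatou).
* `sq_integral_sq_le_half` — **Nash's inequality** `(∫ f²)² ≤ ½ (∫ |f|)² ∫ ‖Df‖²`, `f ∈ C¹_c(ℝ²)`;
  `sq_integral_sq_le_half_of_integrable` / `sq_integral_sq_le_half_of_decay` — the same without
  compact support (`f ∈ L¹ ∩ L²`, `Df ∈ L²`; resp. `|f|, ‖Df‖ ≤ A(1+‖x‖)^{-r}`, `r > 2`): DROP-IN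
  twins of `sq_integral_sq_le_nash[_of_integrable|_of_decay]` with `4 C_GNS` replaced by `1/2`.

The sharp constants (`∫ u² ≤ (4π)⁻¹ (∫‖Du‖)²` by the isoperimetric inequality; Carlen–Loss for
Nash) are not attempted.

## Mathlib / tree search

Mathlib (this pin): `lintegral_pow_le_pow_lintegral_fderiv` and all `eLpNorm_le_eLpNorm_fderiv*`
carry the non-evaluable constant above; `HasCompactSupport.enorm_le_lintegral_Ici_deriv` (the
one-sided pointwise bound, used here) exists, its right-sided twin does not. Tree: searched
`Nash`, `ladyzhenskaya`, `Gagliardo`, `explicit` — every planar statement uses `C_GNS` or an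
existential constant (`exists_ladyzhenskaya_const*`, torus files); nothing explicit on `ℝ²`.

## References

* [GilbargTrudinger2001] D. Gilbarg, N. S. Trudinger, *Elliptic Partial Differential Equations of
  Second Order*, Springer Classics in Mathematics (2001), §7.7, Thm. 7.10 with (7.27)–(7.28)
  ("we have followed the proof of Nirenberg [NI 3] for the case p < n", Notes to Ch. 7).
* [Nirenberg1959] L. Nirenberg, *On elliptic partial differential equations*, Ann. Sc. Norm. Sup.
  Pisa (3) 13 (1959) 115–162 (the product-form proof).
* [Ladyzhenskaya1959] O. A. Ladyzhenskaya, *Solution "in the large" of the nonstationary boundary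
  value problem for the Navier–Stokes system with two space variables*, CPAM 12 (1959) 427–433
  (the inequality `‖u‖₄⁴ ≤ C ‖u‖₂² ‖∇u‖₂²`).
* [Seregin2014] G. Seregin, *Lecture Notes on Regularity Theory for the Navier–Stokes Equations*,
  World Scientific (2014), §5.4 Lemma 5.2 ("Ladyzhenskaya's inequality", constant `2`, with the
  one-sided proof).
* [Nash1958] J. Nash, *Continuity of solutions of parabolic and elliptic equations*, Amer. J. Math.
  80 (1958) 931–954, p. 936.
* [CarlenLoss1995] E. A. Carlen, M. Loss, Duke Math. J. 81 (1995) 135–157 (sharp Nash constant; use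
  for the 2-D vorticity equation).
* [Evans2010] L. C. Evans, *Partial Differential Equations*, 2nd ed., §5.6.1 (Thm. 1: the
  Gagliardo–Nirenberg–Sobolev inequality by the same product argument; Thm. 2: truncation).
-/

noncomputable section

open MeasureTheory Set Function Filter UniformSpace WithLp
open _root_.Topology
open scoped ENNReal NNReal Topology

namespace Literature.Analysis.FluidPDE

namespace PlanarSobolev

variable {F : Type*} [NormedAddCommGroup F] [NormedSpace ℝ F]

/-! ### The two-sided one-dimensional estimate -/

/-- **Right-sided fundamental-theorem bound** (companion of Mathlib's
`HasCompactSupport.enorm_le_lintegral_Ici_deriv`, which integrates over `(-∞, x]`): for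
`φ ∈ C¹_c(ℝ; F)`, `‖φ(x)‖ ≤ ∫_{(x, ∞)} ‖φ'‖` (`φ(x) = -∫_x^∞ φ'`).
[cite: GilbargTrudinger2001, §7.7 proof of Thm. 7.10 (the pointwise bound before (7.27))] -/
theorem enorm_le_lintegral_Ioi_deriv {f : ℝ → F} (hf : ContDiff ℝ 1 f)
    (h'f : HasCompactSupport f) (x : ℝ) :
    ‖f x‖ₑ ≤ ∫⁻ y in Ioi x, ‖deriv f y‖ₑ := by
  let I : F →L[ℝ] Completion F := Completion.toComplL
  let f' : ℝ → Completion F := I ∘ f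
  have hf' : ContDiff ℝ 1 f' := hf.continuousLinearMap_comp I
  have h'f' : HasCompactSupport f' := h'f.comp_left rfl
  have : ‖f' x‖ₑ ≤ ∫⁻ y in Ioi x, ‖deriv f' y‖ₑ := by
    rw [← enorm_neg, ← HasCompactSupport.integral_Ioi_deriv_eq hf' h'f' x]
    exact enorm_integral_le_lintegral_enorm _
  convert! this with y
  · simp [f', I, Completion.enorm_coe]
  · rw [fderiv_comp_deriv _ I.differentiableAt (hf.differentiable one_ne_zero _)]
    simp only [ContinuousLinearMap.fderiv]
    simp [I]

/-- **Two-sided pointwise bound**: for `φ ∈ C¹_c(ℝ; F)` and every `x`,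
`2 ‖φ(x)‖ ≤ ∫_ℝ ‖φ'‖` — the sum of `‖φ(x)‖ ≤ ∫_{(-∞,x]} ‖φ'‖` and `‖φ(x)‖ ≤ ∫_{(x,∞)} ‖φ'‖`.
This factor `½` is what improves the printed one-sided constants below by `2` per direction.
[cite: GilbargTrudinger2001, §7.7 proof of Thm. 7.10 (one-sided form `|u(x)| ≤ ∫_{-∞}^{x_i} |D_i u| dx_i`)] -/
theorem two_mul_enorm_le_lintegral_deriv {f : ℝ → F} (hf : ContDiff ℝ 1 f)
    (h'f : HasCompactSupport f) (x : ℝ) :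
    2 * ‖f x‖ₑ ≤ ∫⁻ y, ‖deriv f y‖ₑ := by
  calc 2 * ‖f x‖ₑ = ‖f x‖ₑ + ‖f x‖ₑ := two_mul _
    _ ≤ (∫⁻ y in Iic x, ‖deriv f y‖ₑ) + ∫⁻ y in Ioi x, ‖deriv f y‖ₑ :=
        add_le_add (h'f.enorm_le_lintegral_Ici_deriv hf x) (enorm_le_lintegral_Ioi_deriv hf h'f x)
    _ = ∫⁻ y, ‖deriv f y‖ₑ := by
        rw [← lintegral_union measurableSet_Ioi (Iic_disjoint_Ioi le_rfl), Iic_union_Ioi,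
          Measure.restrict_univ]

/-! ### The plane: coordinates, and the Gagliardo–Nirenberg product form -/

/-- The coordinate parametrisation `(s, t) ↦ s e₀ + t e₁` of `EuclideanSpace ℝ (Fin 2)` is
`toLp 2 ∘ finTwoArrow.symm`. [folklore] -/
private theorem smul_single_add_smul_single_eq (z : ℝ × ℝ) :
    (z.1 • EuclideanSpace.single (0 : Fin 2) (1 : ℝ) + z.2 • EuclideanSpace.single (1 : Fin 2) (1 : ℝ)
      : EuclideanSpace ℝ (Fin 2)) = toLp 2 (MeasurableEquiv.finTwoArrow.symm z) := by
  ext i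
  fin_cases i <;> simp [MeasurableEquiv.finTwoArrow]

/-- The coordinate parametrisation `(s, t) ↦ s e₀ + t e₁` of the Euclidean plane preserves
Lebesgue measure (`ℝ × ℝ → EuclideanSpace ℝ (Fin 2)`). [folklore] -/
private theorem measurePreserving_planeParam :
    MeasurePreserving (fun z : ℝ × ℝ =>
      (z.1 • EuclideanSpace.single (0 : Fin 2) (1 : ℝ) + z.2 • EuclideanSpace.single (1 : Fin 2) (1 : ℝ)
        : EuclideanSpace ℝ (Fin 2))) volume volume := by
  have hfun : (fun z : ℝ × ℝ =>
      (z.1 • EuclideanSpace.single (0 : Fin 2) (1 : ℝ) + z.2 • EuclideanSpace.single (1 : Fin 2) (1 : ℝ)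
        : EuclideanSpace ℝ (Fin 2))) =
      (toLp 2) ∘ (MeasurableEquiv.finTwoArrow (α := ℝ)).symm := by
    funext z; exact smul_single_add_smul_single_eq z
  rw [hfun]
  exact (PiLp.volume_preserving_toLp (Fin 2)).comp (volume_preserving_finTwoArrow ℝ).symm

variable {u : EuclideanSpace ℝ (Fin 2) → F}

/-- **Gagliardo–Nirenberg inequality on the plane, product form (extended-real version).** For
`u ∈ C¹_c(ℝ²; F)`,

  `4 ∫ ‖u‖² dx ≤ (∫ ‖Du(x) e₀‖ dx) · (∫ ‖Du(x) e₁‖ dx)`,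

`e₀ = EuclideanSpace.single 0 1`, `e₁ = EuclideanSpace.single 1 1`. Proof (Nirenberg's, as in
Gilbarg–Trudinger (7.27)–(7.28) for `n = 2`, with the TWO-sided pointwise bound): along the two
coordinate lines through `x = s e₀ + t e₁`, `2‖u(x)‖ ≤ ∫ ‖Du(σ e₀ + t e₁) e₀‖ dσ` and
`2‖u(x)‖ ≤ ∫ ‖Du(s e₀ + τ e₁) e₁‖ dτ`; multiply and integrate over `(s, t)` (Tonelli; the
coordinate map preserves Lebesgue measure). Printed form (one-sided bound, hence without the `4`):
`‖u‖_{2} ≤ (∫ |D₁u| · ∫ |D₂u|)^{1/2}`.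
[cite: GilbargTrudinger2001, §7.7 Thm. 7.10, (7.27)–(7.28) with n = 2] -/
theorem four_mul_lintegral_sq_le (hu : ContDiff ℝ 1 u) (h2u : HasCompactSupport u) :
    4 * ∫⁻ x, ‖u x‖ₑ ^ 2 ≤
      (∫⁻ x, ‖fderiv ℝ u x (EuclideanSpace.single 0 1)‖ₑ) *
        ∫⁻ x, ‖fderiv ℝ u x (EuclideanSpace.single 1 1)‖ₑ := by
  set e0 : EuclideanSpace ℝ (Fin 2) := EuclideanSpace.single 0 1 with he0
  set e1 : EuclideanSpace ℝ (Fin 2) := EuclideanSpace.single 1 1 with he1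
  set Φ : ℝ × ℝ → EuclideanSpace ℝ (Fin 2) := fun z => z.1 • e0 + z.2 • e1 with hΦ
  have hΦm : MeasurePreserving Φ volume volume := measurePreserving_planeParam
  have hΦc : Continuous Φ := by
    simp only [hΦ]
    fun_prop
  have hud : Differentiable ℝ u := hu.differentiable one_ne_zero
  have hDc : Continuous (fderiv ℝ u) := hu.continuous_fderiv one_ne_zero
  -- the two integrands on `ℝ × ℝ`
  set g0 : ℝ × ℝ → ℝ≥0∞ := fun z => ‖fderiv ℝ u (Φ z) e0‖ₑ with hg0
  set g1 : ℝ × ℝ → ℝ≥0∞ := fun z => ‖fderiv ℝ u (Φ z) e1‖ₑ with hg1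
  have hg0c : Continuous fun z : ℝ × ℝ => fderiv ℝ u (Φ z) e0 :=
    (hDc.comp hΦc).clm_apply continuous_const
  have hg1c : Continuous fun z : ℝ × ℝ => fderiv ℝ u (Φ z) e1 :=
    (hDc.comp hΦc).clm_apply continuous_const
  have hg0m : Measurable g0 := hg0c.enorm.measurable
  have hg1m : Measurable g1 := hg1c.enorm.measurable
  -- derivatives along the coordinate lines
  have hline0 : ∀ t s : ℝ,
      HasDerivAt (fun σ : ℝ => u (Φ (σ, t))) (fderiv ℝ u (Φ (s, t)) e0) s := by
    intro t s
    have hL : HasDerivAt (fun σ : ℝ => Φ (σ, t)) e0 s := by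
      have h := ((hasDerivAt_id s).smul_const e0).add_const (t • e1)
      simpa [hΦ] using h
    exact (hud _).hasFDerivAt.comp_hasDerivAt s hL
  have hline1 : ∀ s t : ℝ,
      HasDerivAt (fun τ : ℝ => u (Φ (s, τ))) (fderiv ℝ u (Φ (s, t)) e1) t := by
    intro s t
    have hL : HasDerivAt (fun τ : ℝ => Φ (s, τ)) e1 t := by
      have h := ((hasDerivAt_id t).smul_const e1).const_add (s • e0)
      simpa [hΦ] using h
    exact (hud _).hasFDerivAt.comp_hasDerivAt t hL
  -- the coordinate lines are isometric copies of `ℝ`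
  have hne0 : ‖e0‖ = 1 := by simp [he0]
  have hne1 : ‖e1‖ = 1 := by simp [he1]
  have hiso0 : ∀ t : ℝ, Isometry (fun σ : ℝ => Φ (σ, t)) := by
    intro t
    refine Isometry.of_dist_eq fun a b => ?_
    simp only [hΦ, dist_eq_norm]
    rw [show a • e0 + t • e1 - (b • e0 + t • e1) = (a - b) • e0 by rw [sub_smul]; abel,
      norm_smul, hne0, mul_one, Real.norm_eq_abs]
  have hiso1 : ∀ s : ℝ, Isometry (fun τ : ℝ => Φ (s, τ)) := by
    intro s
    refine Isometry.of_dist_eq fun a b => ?_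
    simp only [hΦ, dist_eq_norm]
    rw [show s • e0 + a • e1 - (s • e0 + b • e1) = (a - b) • e1 by rw [sub_smul]; abel,
      norm_smul, hne1, mul_one, Real.norm_eq_abs]
  have hcs0 : ∀ t : ℝ, HasCompactSupport (fun σ : ℝ => u (Φ (σ, t))) := fun t =>
    h2u.comp_isClosedEmbedding (hiso0 t).isClosedEmbedding
  have hcs1 : ∀ s : ℝ, HasCompactSupport (fun τ : ℝ => u (Φ (s, τ))) := fun s =>
    h2u.comp_isClosedEmbedding (hiso1 s).isClosedEmbedding
  have hcd0 : ∀ t : ℝ, ContDiff ℝ 1 (fun σ : ℝ => u (Φ (σ, t))) := by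
    intro t
    refine hu.comp ?_
    simp only [hΦ]
    fun_prop
  have hcd1 : ∀ s : ℝ, ContDiff ℝ 1 (fun τ : ℝ => u (Φ (s, τ))) := by
    intro s
    refine hu.comp ?_
    simp only [hΦ]
    fun_prop
  -- the two-sided pointwise bounds along both coordinate lines
  have hpt0 : ∀ z : ℝ × ℝ, 2 * ‖u (Φ z)‖ₑ ≤ ∫⁻ σ, g0 (σ, z.2) := by
    intro z
    have h := two_mul_enorm_le_lintegral_deriv (hcd0 z.2) (hcs0 z.2) z.1
    have hd : (fun y => ‖deriv (fun σ : ℝ => u (Φ (σ, z.2))) y‖ₑ) = fun y => g0 (y, z.2) := by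
      funext y; rw [(hline0 z.2 y).deriv]
    rw [hd] at h
    exact h
  have hpt1 : ∀ z : ℝ × ℝ, 2 * ‖u (Φ z)‖ₑ ≤ ∫⁻ τ, g1 (z.1, τ) := by
    intro z
    have h := two_mul_enorm_le_lintegral_deriv (hcd1 z.1) (hcs1 z.1) z.2
    have hd : (fun y => ‖deriv (fun τ : ℝ => u (Φ (z.1, τ))) y‖ₑ) = fun y => g1 (z.1, y) := by
      funext y; rw [(hline1 z.1 y).deriv]
    rw [hd] at h
    exact h
  have hprod : ∀ z : ℝ × ℝ,
      4 * ‖u (Φ z)‖ₑ ^ 2 ≤ (∫⁻ τ, g1 (z.1, τ)) * ∫⁻ σ, g0 (σ, z.2) := by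
    intro z
    calc 4 * ‖u (Φ z)‖ₑ ^ 2 = (2 * ‖u (Φ z)‖ₑ) * (2 * ‖u (Φ z)‖ₑ) := by ring
      _ ≤ (∫⁻ τ, g1 (z.1, τ)) * ∫⁻ σ, g0 (σ, z.2) := mul_le_mul' (hpt1 z) (hpt0 z)
  -- integrate over the plane (Tonelli)
  have hP1m : Measurable fun s : ℝ => ∫⁻ τ, g1 (s, τ) := hg1m.lintegral_prod_right'
  have hP0m : Measurable fun t : ℝ => ∫⁻ σ, g0 (σ, t) := hg0m.lintegral_prod_left'
  have hum : Measurable fun x : EuclideanSpace ℝ (Fin 2) => ‖u x‖ₑ ^ 2 :=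
    (hu.continuous.enorm.measurable).pow_const 2
  have hI1 : ∫⁻ s, ∫⁻ τ, g1 (s, τ) = ∫⁻ x, ‖fderiv ℝ u x e1‖ₑ := by
    rw [lintegral_lintegral hg1m.aemeasurable]
    simp only [Prod.mk.eta]
    exact hΦm.lintegral_comp (hDc.clm_apply continuous_const).enorm.measurable
  have hI0 : ∫⁻ t, ∫⁻ σ, g0 (σ, t) = ∫⁻ x, ‖fderiv ℝ u x e0‖ₑ := by
    rw [lintegral_lintegral_symm (f := fun t σ => g0 (σ, t))
      (by exact (hg0m.comp measurable_swap).aemeasurable)]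
    simp only [Prod.mk.eta]
    exact hΦm.lintegral_comp (hDc.clm_apply continuous_const).enorm.measurable
  calc 4 * ∫⁻ x, ‖u x‖ₑ ^ 2 = 4 * ∫⁻ z, ‖u (Φ z)‖ₑ ^ 2 := by rw [hΦm.lintegral_comp hum]
    _ = ∫⁻ z, 4 * ‖u (Φ z)‖ₑ ^ 2 := (lintegral_const_mul _ (hum.comp hΦm.measurable)).symm
    _ ≤ ∫⁻ z : ℝ × ℝ, (∫⁻ τ, g1 (z.1, τ)) * ∫⁻ σ, g0 (σ, z.2) := lintegral_mono fun z => hprod z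
    _ = (∫⁻ s, ∫⁻ τ, g1 (s, τ)) * ∫⁻ t, ∫⁻ σ, g0 (σ, t) :=
        lintegral_prod_mul hP1m.aemeasurable hP0m.aemeasurable
    _ = (∫⁻ x, ‖fderiv ℝ u x e1‖ₑ) * ∫⁻ x, ‖fderiv ℝ u x e0‖ₑ := by rw [hI1, hI0]
    _ = (∫⁻ x, ‖fderiv ℝ u x e0‖ₑ) * ∫⁻ x, ‖fderiv ℝ u x e1‖ₑ := mul_comm _ _

/-- `|L e₀| + |L e₁| ≤ √2 ‖L‖` for a real functional `L` on the Euclidean plane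
(`|L e₀| + |L e₁| = L(±e₀ ± e₁) ≤ ‖L‖ ‖±e₀ ± e₁‖ = √2 ‖L‖`). [folklore] -/
private theorem abs_apply_single_add_abs_apply_single_le (L : EuclideanSpace ℝ (Fin 2) →L[ℝ] ℝ) :
    |L (EuclideanSpace.single 0 1)| + |L (EuclideanSpace.single 1 1)| ≤ Real.sqrt 2 * ‖L‖ := by
  set e0 : EuclideanSpace ℝ (Fin 2) := EuclideanSpace.single 0 1 with he0
  set e1 : EuclideanSpace ℝ (Fin 2) := EuclideanSpace.single 1 1 with he1
  -- signs
  obtain ⟨σ0, hσ0, h0⟩ : ∃ σ : ℝ, σ ^ 2 = 1 ∧ σ * L e0 = |L e0| := by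
    rcases le_total 0 (L e0) with h | h
    · exact ⟨1, by norm_num, by rw [one_mul, abs_of_nonneg h]⟩
    · exact ⟨-1, by norm_num, by rw [abs_of_nonpos h]; ring⟩
  obtain ⟨σ1, hσ1, h1⟩ : ∃ σ : ℝ, σ ^ 2 = 1 ∧ σ * L e1 = |L e1| := by
    rcases le_total 0 (L e1) with h | h
    · exact ⟨1, by norm_num, by rw [one_mul, abs_of_nonneg h]⟩
    · exact ⟨-1, by norm_num, by rw [abs_of_nonpos h]; ring⟩
  set v : EuclideanSpace ℝ (Fin 2) := σ0 • e0 + σ1 • e1 with hv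
  have hLv : L v = |L e0| + |L e1| := by
    rw [hv, map_add, map_smul, map_smul, smul_eq_mul, smul_eq_mul, h0, h1]
  have hnv : ‖v‖ = Real.sqrt 2 := by
    rw [EuclideanSpace.norm_eq]
    congr 1
    simp [hv, he0, he1, Fin.sum_univ_two, hσ0, hσ1]
    norm_num
  calc |L e0| + |L e1| = L v := hLv.symm
    _ ≤ |L v| := le_abs_self _
    _ ≤ ‖L‖ * ‖v‖ := by rw [← Real.norm_eq_abs]; exact L.le_opNorm v
    _ = Real.sqrt 2 * ‖L‖ := by rw [hnv, mul_comm]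

/-- **Gagliardo–Nirenberg inequality on the plane, product form (real version).** For
`u ∈ C¹_c(ℝ²; F)`: `4 ∫ ‖u‖² ≤ (∫ ‖Du e₀‖) (∫ ‖Du e₁‖)` (all integrands continuous with compact
support). Printed one-sided form: `‖u‖₂² ≤ ∫ |D₁u| · ∫ |D₂u|`.
[cite: GilbargTrudinger2001, §7.7 Thm. 7.10, (7.27)–(7.28) with n = 2] -/
theorem four_mul_integral_norm_sq_le (hu : ContDiff ℝ 1 u) (h2u : HasCompactSupport u) :
    4 * ∫ x, ‖u x‖ ^ 2 ≤
      (∫ x, ‖fderiv ℝ u x (EuclideanSpace.single 0 1)‖) *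
        ∫ x, ‖fderiv ℝ u x (EuclideanSpace.single 1 1)‖ := by
  have h := four_mul_lintegral_sq_le hu h2u
  have hDc : Continuous (fderiv ℝ u) := hu.continuous_fderiv one_ne_zero
  have hDs : HasCompactSupport (fderiv ℝ u) := h2u.fderiv (𝕜 := ℝ)
  have hi2 : Integrable fun x => ‖u x‖ ^ 2 :=
    (hu.continuous.norm.pow 2).integrable_of_hasCompactSupport
      (h2u.mono fun x hx => by
        simp only [Function.mem_support, ne_eq, Pi.pow_apply] at hx ⊢
        intro h0; exact hx (by rw [h0, norm_zero, zero_pow two_ne_zero]))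
  have hiD : ∀ w : EuclideanSpace ℝ (Fin 2), Integrable fun x => ‖fderiv ℝ u x w‖ := fun w =>
    (hDc.clm_apply continuous_const).norm.integrable_of_hasCompactSupport
      ((hDs.mono fun x hx => by
        simp only [Function.mem_support, ne_eq] at hx ⊢
        intro h0; exact hx (by rw [h0]; simp)).norm)
  have hL : ∫⁻ x, ‖u x‖ₑ ^ 2 = ENNReal.ofReal (∫ x, ‖u x‖ ^ 2) := by
    rw [ofReal_integral_eq_lintegral_ofReal hi2 (Eventually.of_forall fun x => by positivity)]
    refine lintegral_congr fun x => ?_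
    rw [← ofReal_norm, ENNReal.ofReal_pow (norm_nonneg _)]
  have hR : ∀ w : EuclideanSpace ℝ (Fin 2),
      ∫⁻ x, ‖fderiv ℝ u x w‖ₑ = ENNReal.ofReal (∫ x, ‖fderiv ℝ u x w‖) := fun w => by
    rw [ofReal_integral_eq_lintegral_ofReal (hiD w) (Eventually.of_forall fun x => norm_nonneg _)]
    exact lintegral_congr fun x => (ofReal_norm _).symm
  rw [hL, hR, hR, ← ENNReal.ofReal_mul (integral_nonneg fun x => norm_nonneg _),
    show (4 : ℝ≥0∞) = ENNReal.ofReal 4 by norm_num,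
    ← ENNReal.ofReal_mul (by norm_num : (0:ℝ) ≤ 4)] at h
  exact (ENNReal.ofReal_le_ofReal_iff (mul_nonneg (integral_nonneg fun x => norm_nonneg _)
    (integral_nonneg fun x => norm_nonneg _))).1 h

/-- **Planar Gagliardo–Nirenberg inequality, vector-valued, explicit constant `¼`.** For
`u ∈ C¹_c(ℝ²; F)`: `∫ ‖u‖² ≤ ¼ (∫ ‖Du‖)²` (from the product form and `‖Du eᵢ‖ ≤ ‖Du‖`).
Printed (one-sided): `‖u‖₂ ≤ (∏ᵢ ∫|Dᵢu|)^{1/2} ≤ ‖Du‖₁`.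
[cite: GilbargTrudinger2001, §7.7 Thm. 7.10, (7.27)–(7.28) with n = 2] -/
theorem integral_norm_sq_le_quarter (hu : ContDiff ℝ 1 u) (h2u : HasCompactSupport u) :
    ∫ x, ‖u x‖ ^ 2 ≤ (1 / 4) * (∫ x, ‖fderiv ℝ u x‖) ^ 2 := by
  have h := four_mul_integral_norm_sq_le hu h2u
  have hDc : Continuous (fderiv ℝ u) := hu.continuous_fderiv one_ne_zero
  have hDs : HasCompactSupport (fderiv ℝ u) := h2u.fderiv (𝕜 := ℝ)
  have hiD : Integrable fun x => ‖fderiv ℝ u x‖ := hDc.norm.integrable_of_hasCompactSupport hDs.norm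
  have hle : ∀ i : Fin 2, ∫ x, ‖fderiv ℝ u x (EuclideanSpace.single i 1)‖ ≤ ∫ x, ‖fderiv ℝ u x‖ := by
    intro i
    refine integral_mono_of_nonneg (Eventually.of_forall fun x => norm_nonneg _) hiD
      (Eventually.of_forall fun x => ?_)
    calc ‖fderiv ℝ u x (EuclideanSpace.single i 1)‖
        ≤ ‖fderiv ℝ u x‖ * ‖(EuclideanSpace.single i (1 : ℝ) : EuclideanSpace ℝ (Fin 2))‖ :=
          (fderiv ℝ u x).le_opNorm _
      _ = ‖fderiv ℝ u x‖ := by simp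
  have h0 : ∀ i : Fin 2, 0 ≤ ∫ x, ‖fderiv ℝ u x (EuclideanSpace.single i 1)‖ := fun i =>
    integral_nonneg fun x => norm_nonneg _
  have := mul_le_mul (hle 0) (hle 1) (h0 1) ((h0 0).trans (hle 0))
  linarith

/-- **Planar Gagliardo–Nirenberg inequality, scalar, explicit constant `⅛`.** For
`u ∈ C¹_c(ℝ²)`: `∫ u² ≤ ⅛ (∫ ‖Du‖)²`, i.e. `‖u‖₂ ≤ (2√2)⁻¹ ‖Du‖₁` — from the product form,
`4ab ≤ (a + b)²` and `|Du e₀| + |Du e₁| ≤ √2 ‖Du‖`. Printed (one-sided pointwise bound):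
`‖u‖₂ ≤ ½ ∫ (|D₁u| + |D₂u|) ≤ 2^{-1/2} ‖Du‖₁` (Gilbarg–Trudinger (7.28), `n = 2`); the two-sided
bound gives the extra factor `½`. (Sharp: `(4π)^{-1/2}`, isoperimetric — not proved here.)
[cite: GilbargTrudinger2001, §7.7 Thm. 7.10, (7.28) with n = 2] -/
theorem integral_sq_le_eighth {u : EuclideanSpace ℝ (Fin 2) → ℝ} (hu : ContDiff ℝ 1 u)
    (h2u : HasCompactSupport u) :
    ∫ x, u x ^ 2 ≤ (1 / 8) * (∫ x, ‖fderiv ℝ u x‖) ^ 2 := by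
  have h := four_mul_integral_norm_sq_le hu h2u
  have hsq : ∫ x, u x ^ 2 = ∫ x, ‖u x‖ ^ 2 :=
    integral_congr_ae (Eventually.of_forall fun x => by simp [sq_abs])
  rw [hsq]
  have hDc : Continuous (fderiv ℝ u) := hu.continuous_fderiv one_ne_zero
  have hDs : HasCompactSupport (fderiv ℝ u) := h2u.fderiv (𝕜 := ℝ)
  have hiD : Integrable fun x => ‖fderiv ℝ u x‖ := hDc.norm.integrable_of_hasCompactSupport hDs.norm
  have hiDw : ∀ w : EuclideanSpace ℝ (Fin 2), Integrable fun x => ‖fderiv ℝ u x w‖ := fun w =>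
    (hDc.clm_apply continuous_const).norm.integrable_of_hasCompactSupport
      ((hDs.mono fun x hx => by
        simp only [Function.mem_support, ne_eq] at hx ⊢
        intro h0; exact hx (by rw [h0]; simp)).norm)
  set D0 := ∫ x, ‖fderiv ℝ u x (EuclideanSpace.single 0 1)‖ with hD0
  set D1 := ∫ x, ‖fderiv ℝ u x (EuclideanSpace.single 1 1)‖ with hD1
  set G := ∫ x, ‖fderiv ℝ u x‖ with hG
  have hsum : D0 + D1 ≤ Real.sqrt 2 * G := by
    rw [hD0, hD1, hG, ← integral_add (hiDw _) (hiDw _), ← integral_const_mul]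
    refine integral_mono ((hiDw _).add (hiDw _)) (hiD.const_mul _) fun x => ?_
    simpa only [Real.norm_eq_abs] using abs_apply_single_add_abs_apply_single_le (fderiv ℝ u x)
  have h0 : 0 ≤ D0 := integral_nonneg fun x => norm_nonneg _
  have h1 : 0 ≤ D1 := integral_nonneg fun x => norm_nonneg _
  have hG0 : 0 ≤ G := integral_nonneg fun x => norm_nonneg _
  have hs2 : Real.sqrt 2 ^ 2 = 2 := Real.sq_sqrt (by norm_num)
  -- `4 D0 D1 ≤ (D0 + D1)² ≤ 2 G²`
  nlinarith [sq_nonneg (D0 - D1), mul_self_nonneg (Real.sqrt 2 * G),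
    mul_le_mul hsum hsum (add_nonneg h0 h1) ((add_nonneg h0 h1).trans hsum)]

/-! ### Ladyzhenskaya's and Nash's inequalities with explicit constants -/

/-- Cauchy–Schwarz for non-negative continuous compactly supported functions on the plane:
`(∫ f g)² ≤ (∫ f²)(∫ g²)`. [folklore] -/
private theorem sq_integral_mul_le {f g : EuclideanSpace ℝ (Fin 2) → ℝ} (hf : Continuous f)
    (hg : Continuous g) (hfc : HasCompactSupport f) (hgc : HasCompactSupport g)
    (hf0 : ∀ x, 0 ≤ f x) (hg0 : ∀ x, 0 ≤ g x) :
    (∫ x, f x * g x) ^ 2 ≤ (∫ x, f x ^ 2) * ∫ x, g x ^ 2 := by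
  have h := integral_mul_le_Lp_mul_Lq_of_nonneg (μ := (volume : Measure (EuclideanSpace ℝ (Fin 2))))
    Real.HolderConjugate.two_two (Eventually.of_forall hf0) (Eventually.of_forall hg0)
    (hf.memLp_of_hasCompactSupport hfc) (hg.memLp_of_hasCompactSupport hgc)
  have hA : 0 ≤ ∫ x, f x ^ 2 := integral_nonneg fun x => by positivity
  have hB : 0 ≤ ∫ x, g x ^ 2 := integral_nonneg fun x => by positivity
  have hI : 0 ≤ ∫ x, f x * g x := integral_nonneg fun x => mul_nonneg (hf0 x) (hg0 x)
  have hA' : (∫ x, f x ^ (2 : ℝ)) = ∫ x, f x ^ 2 :=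
    integral_congr_ae (Eventually.of_forall fun x => by simp)
  have hB' : (∫ x, g x ^ (2 : ℝ)) = ∫ x, g x ^ 2 :=
    integral_congr_ae (Eventually.of_forall fun x => by simp)
  rw [hA', hB', show (1 : ℝ) / 2 = 2⁻¹ by norm_num] at h
  have h2 := pow_le_pow_left₀ hI h 2
  rw [mul_pow, ← Real.rpow_natCast ((∫ x, f x ^ 2) ^ (2⁻¹ : ℝ)) 2,
    ← Real.rpow_natCast ((∫ x, g x ^ 2) ^ (2⁻¹ : ℝ)) 2, ← Real.rpow_mul hA, ← Real.rpow_mul hB] at h2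
  norm_num at h2
  exact h2

/-- **Ladyzhenskaya's inequality on the plane with constant `½`.** For `f ∈ C¹_c(ℝ²)`:

  `∫ f⁴ ≤ ½ (∫ f²) (∫ ‖Df‖²)`.

Proof: `integral_sq_le_eighth` for `u = f²` (`‖D(f²)‖ = 2|f|‖Df‖`) and Cauchy–Schwarz
`(∫ |f|‖Df‖)² ≤ ∫ f² ∫ ‖Df‖²`. Printed with constant `2` (one-sided pointwise bound):
`‖u‖₄⁴ ≤ 2 ‖u‖₂² ‖∇u‖₂²` for `u ∈ C₀^∞` (Ladyzhenskaya 1959; Seregin, Lemma 5.2).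
[cite: Ladyzhenskaya1959, Lemma 1 (the inequality, n = 2); Seregin2014, §5.4 Lemma 5.2 ("Ladyzhenskaya's inequality", constant 2)] -/
theorem integral_pow_four_le_half {f : EuclideanSpace ℝ (Fin 2) → ℝ} (hf : ContDiff ℝ 1 f)
    (hfc : HasCompactSupport f) :
    ∫ x, f x ^ 4 ≤ (1 / 2) * (∫ x, f x ^ 2) * ∫ x, ‖fderiv ℝ f x‖ ^ 2 := by
  have hfd : Differentiable ℝ f := hf.differentiable one_ne_zero
  have hfcont : Continuous f := hf.continuous
  have hDc : Continuous fun x => fderiv ℝ f x := hf.continuous_fderiv one_ne_zero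
  have hDs : HasCompactSupport fun x => fderiv ℝ f x := hfc.fderiv (𝕜 := ℝ)
  have hsupp_of : ∀ {g : EuclideanSpace ℝ (Fin 2) → ℝ}, (∀ x, f x = 0 → g x = 0) →
      HasCompactSupport g := fun {g} hg => hfc.mono fun x hx => by
    simp only [Function.mem_support, ne_eq] at hx ⊢
    contrapose! hx
    exact hg x hx
  -- `u = f²`
  set u : EuclideanSpace ℝ (Fin 2) → ℝ := fun x => f x ^ 2 with hu
  have huc : ContDiff ℝ 1 u := hf.pow 2
  have hus : HasCompactSupport u := hsupp_of fun x hx => by simp [hu, hx]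
  have hud : ∀ x, HasFDerivAt u ((2 * f x) • fderiv ℝ f x) x := by
    intro x
    have := ((hfd x).hasFDerivAt).pow 2
    simpa using this
  have hDu : ∀ x, ‖fderiv ℝ u x‖ = 2 * (|f x| * ‖fderiv ℝ f x‖) := by
    intro x
    rw [(hud x).fderiv, norm_smul, Real.norm_eq_abs, abs_mul, abs_of_pos two_pos, mul_assoc]
  have h8 := integral_sq_le_eighth huc hus
  have e4 : ∫ x, u x ^ 2 = ∫ x, f x ^ 4 :=
    integral_congr_ae (Eventually.of_forall fun x => by simp only [hu]; ring)
  have eD : ∫ x, ‖fderiv ℝ u x‖ = 2 * ∫ x, |f x| * ‖fderiv ℝ f x‖ := by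
    rw [← integral_const_mul]
    exact integral_congr_ae (Eventually.of_forall fun x => hDu x)
  rw [e4, eD] at h8
  -- Cauchy–Schwarz `(∫ |f| ‖Df‖)² ≤ ∫ f² ∫ ‖Df‖²`
  have hCS := sq_integral_mul_le (f := fun x => |f x|) (g := fun x => ‖fderiv ℝ f x‖)
    (by fun_prop) hDc.norm (hsupp_of fun x hx => by simp [hx]) hDs.norm
    (fun x => abs_nonneg _) (fun x => norm_nonneg _)
  simp only [sq_abs] at hCS
  calc ∫ x, f x ^ 4 ≤ 1 / 8 * (2 * ∫ x, |f x| * ‖fderiv ℝ f x‖) ^ 2 := h8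
    _ = 1 / 2 * (∫ x, |f x| * ‖fderiv ℝ f x‖) ^ 2 := by ring
    _ ≤ 1 / 2 * ((∫ x, f x ^ 2) * ∫ x, ‖fderiv ℝ f x‖ ^ 2) := by gcongr
    _ = (1 / 2) * (∫ x, f x ^ 2) * ∫ x, ‖fderiv ℝ f x‖ ^ 2 := by ring

/-- **Nash's inequality on the plane with constant `½`.** For `f ∈ C¹_c(ℝ²)`:

  `(∫ f²)² ≤ ½ (∫ |f|)² ∫ ‖Df‖²`

(Cauchy–Schwarz twice, `(∫f²)³ ≤ (∫|f|)² ∫f⁴`, and Ladyzhenskaya `∫f⁴ ≤ ½ ∫f² ∫‖Df‖²`). This is the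
tree's `sq_integral_sq_le_nash` with `4 C_GNS` replaced by the number `1/2`.
[cite: Nash1958, p. 936 (the inequality for n = 2); CarlenLoss1995, §1 (Nash's inequality for the 2-D vorticity equation; sharp constant)] -/
theorem sq_integral_sq_le_half {f : EuclideanSpace ℝ (Fin 2) → ℝ} (hf : ContDiff ℝ 1 f)
    (hfc : HasCompactSupport f) :
    (∫ x, f x ^ 2) ^ 2 ≤ (1 / 2) * (∫ x, |f x|) ^ 2 * ∫ x, ‖fderiv ℝ f x‖ ^ 2 := by
  have hfcont : Continuous f := hf.continuous
  have hsupp_of : ∀ {g : EuclideanSpace ℝ (Fin 2) → ℝ}, (∀ x, f x = 0 → g x = 0) →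
      HasCompactSupport g := fun {g} hg => hfc.mono fun x hx => by
    simp only [Function.mem_support, ne_eq] at hx ⊢
    contrapose! hx
    exact hg x hx
  set X : ℝ := ∫ x, f x ^ 2 with hX
  set a : ℝ := ∫ x, |f x| with ha
  set T : ℝ := ∫ x, |f x| ^ 3 with hT
  set Q : ℝ := ∫ x, f x ^ 4 with hQ
  set D : ℝ := ∫ x, ‖fderiv ℝ f x‖ ^ 2 with hD
  have hX0 : 0 ≤ X := integral_nonneg fun x => by positivity
  have hD0 : 0 ≤ D := integral_nonneg fun x => by positivity
  -- Cauchy–Schwarz twice: `X² ≤ a T`, `T² ≤ X Q`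
  have hCS1 : X ^ 2 ≤ a * T := by
    have h := sq_integral_mul_le (f := fun x => Real.sqrt |f x|)
      (g := fun x => |f x| * Real.sqrt |f x|) (by fun_prop) (by fun_prop)
      (hsupp_of fun x hx => by simp [hx]) (hsupp_of fun x hx => by simp [hx])
      (fun x => Real.sqrt_nonneg _) (fun x => by positivity)
    have e1 : (fun x => Real.sqrt |f x| * (|f x| * Real.sqrt |f x|)) = fun x => f x ^ 2 := by
      funext x
      have hs := Real.mul_self_sqrt (abs_nonneg (f x))
      calc Real.sqrt |f x| * (|f x| * Real.sqrt |f x|)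
          = (Real.sqrt |f x| * Real.sqrt |f x|) * |f x| := by ring
        _ = |f x| * |f x| := by rw [hs]
        _ = f x ^ 2 := by rw [← sq, sq_abs]
    have e2 : (fun x => Real.sqrt |f x| ^ 2) = fun x => |f x| := by
      funext x; exact Real.sq_sqrt (abs_nonneg _)
    have e3 : (fun x => (|f x| * Real.sqrt |f x|) ^ 2) = fun x => |f x| ^ 3 := by
      funext x
      rw [mul_pow, Real.sq_sqrt (abs_nonneg _)]
      ring
    simp only [e1, e2, e3] at h
    exact h
  have hCS2 : T ^ 2 ≤ X * Q := by
    have h := sq_integral_mul_le (f := fun x => |f x|) (g := fun x => f x ^ 2)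
      (by fun_prop) (by fun_prop) (hsupp_of fun x hx => by simp [hx])
      (hsupp_of fun x hx => by simp [hx]) (fun x => abs_nonneg _) (fun x => by positivity)
    have e1 : (fun x => |f x| * f x ^ 2) = fun x => |f x| ^ 3 := by
      funext x; rw [← sq_abs]; ring
    have e2 : (fun x => |f x| ^ 2) = fun x => f x ^ 2 := by funext x; exact sq_abs _
    have e3 : (fun x => (f x ^ 2) ^ 2) = fun x => f x ^ 4 := by funext x; ring
    simp only [e1, e2, e3] at h
    exact h
  -- Ladyzhenskaya: `Q ≤ ½ X D`
  have hQle : Q ≤ 1 / 2 * X * D := integral_pow_four_le_half hf hfc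
  -- combine: `X⁴ ≤ a² T² ≤ a² X Q ≤ ½ a² X² D`
  by_cases hX00 : X = 0
  · rw [hX00, zero_pow two_ne_zero]; positivity
  have hXpos : 0 < X := lt_of_le_of_ne hX0 (Ne.symm hX00)
  have h4 : X ^ 4 ≤ X ^ 2 * (1 / 2 * a ^ 2 * D) := by
    calc X ^ 4 = (X ^ 2) ^ 2 := by ring
      _ ≤ (a * T) ^ 2 := pow_le_pow_left₀ (by positivity) hCS1 2
      _ = a ^ 2 * T ^ 2 := by ring
      _ ≤ a ^ 2 * (X * Q) := mul_le_mul_of_nonneg_left hCS2 (by positivity)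
      _ ≤ a ^ 2 * (X * (1 / 2 * X * D)) := by gcongr
      _ = X ^ 2 * (1 / 2 * a ^ 2 * D) := by ring
  have hX2 : 0 < X ^ 2 := by positivity
  calc X ^ 2 = X ^ 4 / X ^ 2 := by field_simp
    _ ≤ X ^ 2 * (1 / 2 * a ^ 2 * D) / X ^ 2 := by gcongr
    _ = 1 / 2 * a ^ 2 * D := by field_simp

/-! ### Without compact support: truncation -/

/-- **Nash's inequality on the plane, constant `½`, without compact support.** For every `C¹`
function `f : ℝ² → ℝ` with `f ∈ L¹`, `f ∈ L²`, `Df ∈ L²`: `(∫ f²)² ≤ ½ (∫ |f|)² ∫ ‖Df‖²`.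
Truncation `f_n = χ_{n+1} f` (the tree's `cutoff`) and dominated convergence, verbatim as in
`sq_integral_sq_le_nash_of_integrable`, whose drop-in twin this is (`4 C_GNS ↦ 1/2`).
[cite: Nash1958, p. 936 (the inequality for n = 2); Evans2010, §5.6.1 Thm. 2 (truncation)] -/
theorem sq_integral_sq_le_half_of_integrable {f : EuclideanSpace ℝ (Fin 2) → ℝ}
    (hf : ContDiff ℝ 1 f) (h1 : Integrable f) (h2 : Integrable fun x => f x ^ 2)
    (hD : Integrable fun x => ‖fderiv ℝ f x‖ ^ 2) :
    (∫ x, f x ^ 2) ^ 2 ≤ (1 / 2) * (∫ x, |f x|) ^ 2 * ∫ x, ‖fderiv ℝ f x‖ ^ 2 := by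
  obtain ⟨C, hC0, hC⟩ := exists_norm_fderiv_cutoff_le (E := EuclideanSpace ℝ (Fin 2))
  have hfc : Continuous f := hf.continuous
  have hDc : Continuous fun x => fderiv ℝ f x := hf.continuous_fderiv one_ne_zero
  -- the truncations `f_n = χ_{n+1} f`
  set fn : ℕ → EuclideanSpace ℝ (Fin 2) → ℝ := fun n x => cutoff ((n : ℝ) + 1) x * f x with hfn
  have hRpos : ∀ n : ℕ, (0 : ℝ) < n + 1 := fun n => by positivity
  have hfn1 : ∀ n, ContDiff ℝ 1 (fn n) := fun n => (contDiff_cutoff _).mul hf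
  have hfns : ∀ n, HasCompactSupport (fn n) := fun n =>
    (hasCompactSupport_cutoff (hRpos n)).mul_right
  -- Nash for each truncation, with `∫ |f_n| ≤ ∫ |f|`
  have hle1 : ∀ n, ∫ x, |fn n x| ≤ ∫ x, |f x| := by
    intro n
    refine integral_mono_of_nonneg (Eventually.of_forall fun x => abs_nonneg _) h1.abs
      (Eventually.of_forall fun x => ?_)
    simp only [hfn, abs_mul]
    exact mul_le_of_le_one_left (abs_nonneg _) (abs_cutoff_le_one _ _)
  have hN : ∀ n, (∫ x, fn n x ^ 2) ^ 2 ≤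
      1 / 2 * (∫ x, |f x|) ^ 2 * ∫ x, ‖fderiv ℝ (fn n) x‖ ^ 2 := by
    intro n
    refine (sq_integral_sq_le_half (hfn1 n) (hfns n)).trans ?_
    have h0 : 0 ≤ ∫ x, |fn n x| := integral_nonneg fun x => abs_nonneg _
    have hD0 : 0 ≤ ∫ x, ‖fderiv ℝ (fn n) x‖ ^ 2 := integral_nonneg fun x => sq_nonneg _
    exact mul_le_mul_of_nonneg_right
      (mul_le_mul_of_nonneg_left (pow_le_pow_left₀ h0 (hle1 n) 2) (by norm_num)) hD0
  -- `∫ f_n² → ∫ f²`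
  have hlim2 : Tendsto (fun n => ∫ x, fn n x ^ 2) atTop (𝓝 (∫ x, f x ^ 2)) := by
    refine tendsto_integral_of_dominated_convergence (fun x => f x ^ 2)
      (fun n => ((hfn1 n).continuous.pow 2).aestronglyMeasurable) h2
      (fun n => Eventually.of_forall fun x => ?_) (Eventually.of_forall fun x => ?_)
    · rw [Real.norm_eq_abs, abs_pow, hfn]
      dsimp only
      rw [abs_mul, mul_pow, ← sq_abs (f x)]
      exact mul_le_of_le_one_left (sq_nonneg _)
        (pow_le_one₀ (abs_nonneg _) (abs_cutoff_le_one _ _))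
    · have h := ((tendsto_cutoff_natCast_add_one x).mul_const (f x)).pow 2
      simpa [hfn] using h
  -- `‖Df_n‖² ≤ 2‖Df‖² + 2C²f²`, and `Df_n(x) = Df(x)` eventually
  have hbd : ∀ n x, ‖fderiv ℝ (fn n) x‖ ^ 2 ≤ 2 * ‖fderiv ℝ f x‖ ^ 2 + 2 * (C ^ 2 * f x ^ 2) := by
    intro n x
    have h := SobolevWholeSpace.norm_fderiv_cutoff_smul_le hf (hC _ (hRpos n)) x
    have h' : ‖fderiv ℝ (fn n) x‖ ≤ ‖fderiv ℝ f x‖ + C * |f x| := by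
      have e : (fun y => cutoff ((n : ℝ) + 1) y • f y) = fn n := by
        funext y; simp [hfn, smul_eq_mul]
      rw [e, Real.norm_eq_abs] at h
      refine h.trans ?_
      gcongr
      exact div_le_self hC0 (by linarith [(Nat.cast_nonneg n : (0 : ℝ) ≤ n)])
    have ha : 0 ≤ ‖fderiv ℝ f x‖ := norm_nonneg _
    have hb : 0 ≤ C * |f x| := by positivity
    calc ‖fderiv ℝ (fn n) x‖ ^ 2 ≤ (‖fderiv ℝ f x‖ + C * |f x|) ^ 2 :=
          pow_le_pow_left₀ (norm_nonneg _) h' 2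
      _ ≤ 2 * ‖fderiv ℝ f x‖ ^ 2 + 2 * (C ^ 2 * f x ^ 2) := by
          rw [show C ^ 2 * f x ^ 2 = (C * |f x|) ^ 2 by rw [mul_pow, sq_abs]]
          nlinarith [sq_nonneg (‖fderiv ℝ f x‖ - C * |f x|)]
  have hev : ∀ x, ∀ᶠ n : ℕ in atTop, fderiv ℝ (fn n) x = fderiv ℝ f x := by
    intro x
    have hT : Tendsto (fun n : ℕ => (n : ℝ) + 1) atTop atTop :=
      tendsto_natCast_atTop_atTop.atTop_add tendsto_const_nhds
    filter_upwards [hT.eventually (eventually_gt_atTop ‖x‖)] with n hn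
    refine Filter.EventuallyEq.fderiv_eq ?_
    have hopen : IsOpen {y : EuclideanSpace ℝ (Fin 2) | ‖y‖ < (n : ℝ) + 1} :=
      isOpen_lt continuous_norm continuous_const
    filter_upwards [hopen.mem_nhds hn] with y hy
    simp only [hfn]
    rw [cutoff_eq_one (hRpos n) (le_of_lt hy), one_mul]
  have hlimD : Tendsto (fun n => ∫ x, ‖fderiv ℝ (fn n) x‖ ^ 2) atTop
      (𝓝 (∫ x, ‖fderiv ℝ f x‖ ^ 2)) := by
    refine tendsto_integral_of_dominated_convergence
      (fun x => 2 * ‖fderiv ℝ f x‖ ^ 2 + 2 * (C ^ 2 * f x ^ 2))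
      (fun n => (((hfn1 n).continuous_fderiv one_ne_zero).norm.pow 2).aestronglyMeasurable)
      ((hD.const_mul 2).add ((h2.const_mul (C ^ 2)).const_mul 2))
      (fun n => Eventually.of_forall fun x => ?_) (Eventually.of_forall fun x => ?_)
    · rw [Real.norm_of_nonneg (sq_nonneg _)]
      exact hbd n x
    · exact tendsto_const_nhds.congr' <| by
        filter_upwards [hev x] with n hn
        rw [hn]
  -- pass to the limit
  exact le_of_tendsto_of_tendsto' (hlim2.pow 2)
    (hlimD.const_mul (1 / 2 * (∫ x, |f x|) ^ 2)) hN

/-- A bound `|θ x| ≤ A (1 + ‖x‖)^{-r}` forces `0 ≤ A` (evaluate at `x = 0`). [folklore] -/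
private theorem nonneg_of_abs_le_mul_rpow_neg {θ : EuclideanSpace ℝ (Fin 2) → ℝ} {A r : ℝ}
    (h : ∀ x, |θ x| ≤ A * (1 + ‖x‖) ^ (-r)) : 0 ≤ A := by
  have h0 := h 0
  rw [norm_zero, add_zero, Real.one_rpow, mul_one] at h0
  exact (abs_nonneg _).trans h0

/-- **Nash's inequality on the plane, constant `½`, for decaying functions.** For every `C¹`
function `f : ℝ² → ℝ` with `|f(x)| ≤ A (1 + ‖x‖)^{-r}` and `‖Df(x)‖ ≤ A (1 + ‖x‖)^{-r}` for some
`r > 2`: `(∫ f²)² ≤ ½ (∫ |f|)² ∫ ‖Df‖²` — the form used for the slices of a classical, rapidly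
decaying solution of the planar vorticity equation; drop-in twin of `sq_integral_sq_le_nash_of_decay`.
[cite: Nash1958, p. 936 (the inequality for n = 2); CarlenLoss1995, §1 (use for 2-D vorticity)] -/
theorem sq_integral_sq_le_half_of_decay {f : EuclideanSpace ℝ (Fin 2) → ℝ} (hf : ContDiff ℝ 1 f)
    {A r : ℝ} (hr : 2 < r) (h0 : ∀ x, |f x| ≤ A * (1 + ‖x‖) ^ (-r))
    (h1 : ∀ x, ‖fderiv ℝ f x‖ ≤ A * (1 + ‖x‖) ^ (-r)) :
    (∫ x, f x ^ 2) ^ 2 ≤ (1 / 2) * (∫ x, |f x|) ^ 2 * ∫ x, ‖fderiv ℝ f x‖ ^ 2 := by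
  have hA : 0 ≤ A := nonneg_of_abs_le_mul_rpow_neg h0
  have hr2 : (Module.finrank ℝ (EuclideanSpace ℝ (Fin 2)) : ℝ) < r := by
    rw [finrank_euclideanSpace_fin]; exact_mod_cast hr
  have hr0 : 0 ≤ r := by linarith
  have hfc : Continuous f := hf.continuous
  have hDc : Continuous fun x => fderiv ℝ f x := hf.continuous_fderiv one_ne_zero
  have hI1 : Integrable f := integrable_of_norm_le_rpow_neg hfc hr2 fun x => by
    rw [Real.norm_eq_abs]; exact h0 x
  have hw1 : ∀ x : EuclideanSpace ℝ (Fin 2), (1 + ‖x‖) ^ (-r) ≤ 1 := fun x => rpow_neg_le_one x hr0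
  have hsq : ∀ {a : ℝ} (x : EuclideanSpace ℝ (Fin 2)), 0 ≤ a → a ≤ A * (1 + ‖x‖) ^ (-r) →
      a ^ 2 ≤ A * A * (1 + ‖x‖) ^ (-r) := by
    intro a x ha hle
    calc a ^ 2 = a * a := sq a
      _ ≤ (A * (1 + ‖x‖) ^ (-r)) * (A * (1 + ‖x‖) ^ (-r)) := mul_le_mul hle hle ha (by positivity)
      _ ≤ (A * 1) * (A * (1 + ‖x‖) ^ (-r)) := by gcongr; exact hw1 x
      _ = A * A * (1 + ‖x‖) ^ (-r) := by ring
  have hI2 : Integrable fun x => f x ^ 2 :=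
    integrable_of_norm_le_rpow_neg (hfc.pow 2) hr2 fun x => by
      rw [Real.norm_of_nonneg (sq_nonneg _), ← sq_abs]
      exact hsq x (abs_nonneg _) (h0 x)
  have hID : Integrable fun x => ‖fderiv ℝ f x‖ ^ 2 :=
    integrable_of_norm_le_rpow_neg (hDc.norm.pow 2) hr2 fun x => by
      rw [Real.norm_of_nonneg (sq_nonneg _)]
      exact hsq x (norm_nonneg _) (h1 x)
  exact sq_integral_sq_le_half_of_integrable hf hI1 hI2 hID

/-- **Ladyzhenskaya's inequality on the plane, constant `½`, without compact support — with
`f ∈ L⁴` as a CONCLUSION.** For every `C¹` function `f : ℝ² → ℝ` with `f ∈ L²` and `Df ∈ L²`: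
`f⁴` is integrable and `∫ f⁴ ≤ ½ (∫ f²) (∫ ‖Df‖²)`. Proof: truncations `f_n = χ_{n+1} f` obey the
compactly supported inequality with `∫ f_n² ≤ ∫ f²`; `∫ ‖Df_n‖² → ∫ ‖Df‖²` by dominated
convergence; Fatou's lemma for `f_n⁴ → f⁴`.
[cite: Ladyzhenskaya1959, Lemma 1 (the inequality, n = 2); Seregin2014, §5.4 Lemma 5.2 (constant 2); Evans2010, §5.6.1 Thm. 2 (truncation)] -/
theorem integral_pow_four_le_half_of_integrable {f : EuclideanSpace ℝ (Fin 2) → ℝ}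
    (hf : ContDiff ℝ 1 f) (h2 : Integrable fun x => f x ^ 2)
    (hD : Integrable fun x => ‖fderiv ℝ f x‖ ^ 2) :
    Integrable (fun x => f x ^ 4) ∧
      ∫ x, f x ^ 4 ≤ (1 / 2) * (∫ x, f x ^ 2) * ∫ x, ‖fderiv ℝ f x‖ ^ 2 := by
  obtain ⟨C, hC0, hC⟩ := exists_norm_fderiv_cutoff_le (E := EuclideanSpace ℝ (Fin 2))
  have hfc : Continuous f := hf.continuous
  have hDc : Continuous fun x => fderiv ℝ f x := hf.continuous_fderiv one_ne_zero
  set X : ℝ := ∫ x, f x ^ 2 with hX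
  set D : ℝ := ∫ x, ‖fderiv ℝ f x‖ ^ 2 with hDdef
  have hX0 : 0 ≤ X := integral_nonneg fun x => sq_nonneg _
  have hD0 : 0 ≤ D := integral_nonneg fun x => sq_nonneg _
  -- truncations
  set fn : ℕ → EuclideanSpace ℝ (Fin 2) → ℝ := fun n x => cutoff ((n : ℝ) + 1) x * f x with hfn
  have hRpos : ∀ n : ℕ, (0 : ℝ) < n + 1 := fun n => by positivity
  have hfn1 : ∀ n, ContDiff ℝ 1 (fn n) := fun n => (contDiff_cutoff _).mul hf
  have hfns : ∀ n, HasCompactSupport (fn n) := fun n =>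
    (hasCompactSupport_cutoff (hRpos n)).mul_right
  have hle2 : ∀ n, ∫ x, fn n x ^ 2 ≤ X := by
    intro n
    refine integral_mono_of_nonneg (Eventually.of_forall fun x => sq_nonneg _) h2
      (Eventually.of_forall fun x => ?_)
    simp only [hfn]
    rw [mul_pow, ← sq_abs (cutoff _ _)]
    exact mul_le_of_le_one_left (sq_nonneg _)
      (pow_le_one₀ (abs_nonneg _) (abs_cutoff_le_one _ _))
  have hN : ∀ n, ∫ x, fn n x ^ 4 ≤ 1 / 2 * X * ∫ x, ‖fderiv ℝ (fn n) x‖ ^ 2 := by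
    intro n
    refine (integral_pow_four_le_half (hfn1 n) (hfns n)).trans ?_
    have hD0' : 0 ≤ ∫ x, ‖fderiv ℝ (fn n) x‖ ^ 2 := integral_nonneg fun x => sq_nonneg _
    exact mul_le_mul_of_nonneg_right (mul_le_mul_of_nonneg_left (hle2 n) (by norm_num)) hD0'
  -- `∫ ‖Df_n‖² → ∫ ‖Df‖²` (dominated convergence, as for Nash)
  have hbd : ∀ n x, ‖fderiv ℝ (fn n) x‖ ^ 2 ≤ 2 * ‖fderiv ℝ f x‖ ^ 2 + 2 * (C ^ 2 * f x ^ 2) := by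
    intro n x
    have h := SobolevWholeSpace.norm_fderiv_cutoff_smul_le hf (hC _ (hRpos n)) x
    have h' : ‖fderiv ℝ (fn n) x‖ ≤ ‖fderiv ℝ f x‖ + C * |f x| := by
      have e : (fun y => cutoff ((n : ℝ) + 1) y • f y) = fn n := by
        funext y; simp [hfn, smul_eq_mul]
      rw [e, Real.norm_eq_abs] at h
      refine h.trans ?_
      gcongr
      exact div_le_self hC0 (by linarith [(Nat.cast_nonneg n : (0 : ℝ) ≤ n)])
    have hb : 0 ≤ C * |f x| := by positivity
    calc ‖fderiv ℝ (fn n) x‖ ^ 2 ≤ (‖fderiv ℝ f x‖ + C * |f x|) ^ 2 :=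
          pow_le_pow_left₀ (norm_nonneg _) h' 2
      _ ≤ 2 * ‖fderiv ℝ f x‖ ^ 2 + 2 * (C ^ 2 * f x ^ 2) := by
          rw [show C ^ 2 * f x ^ 2 = (C * |f x|) ^ 2 by rw [mul_pow, sq_abs]]
          nlinarith [sq_nonneg (‖fderiv ℝ f x‖ - C * |f x|)]
  have hev : ∀ x, ∀ᶠ n : ℕ in atTop, fderiv ℝ (fn n) x = fderiv ℝ f x := by
    intro x
    have hT : Tendsto (fun n : ℕ => (n : ℝ) + 1) atTop atTop :=
      tendsto_natCast_atTop_atTop.atTop_add tendsto_const_nhds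
    filter_upwards [hT.eventually (eventually_gt_atTop ‖x‖)] with n hn
    refine Filter.EventuallyEq.fderiv_eq ?_
    have hopen : IsOpen {y : EuclideanSpace ℝ (Fin 2) | ‖y‖ < (n : ℝ) + 1} :=
      isOpen_lt continuous_norm continuous_const
    filter_upwards [hopen.mem_nhds hn] with y hy
    simp only [hfn]
    rw [cutoff_eq_one (hRpos n) (le_of_lt hy), one_mul]
  have hlimD : Tendsto (fun n => ∫ x, ‖fderiv ℝ (fn n) x‖ ^ 2) atTop (𝓝 D) := by
    refine tendsto_integral_of_dominated_convergence
      (fun x => 2 * ‖fderiv ℝ f x‖ ^ 2 + 2 * (C ^ 2 * f x ^ 2))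
      (fun n => (((hfn1 n).continuous_fderiv one_ne_zero).norm.pow 2).aestronglyMeasurable)
      ((hD.const_mul 2).add ((h2.const_mul (C ^ 2)).const_mul 2))
      (fun n => Eventually.of_forall fun x => ?_) (Eventually.of_forall fun x => ?_)
    · rw [Real.norm_of_nonneg (sq_nonneg _)]
      exact hbd n x
    · exact tendsto_const_nhds.congr' <| by
        filter_upwards [hev x] with n hn
        rw [hn]
  -- Fatou
  have hG : ∀ n, ∫⁻ x, ENNReal.ofReal (fn n x ^ 4) = ENNReal.ofReal (∫ x, fn n x ^ 4) := by
    intro n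
    rw [ofReal_integral_eq_lintegral_ofReal]
    · exact ((hfn1 n).continuous.pow 4).integrable_of_hasCompactSupport
        ((hfns n).mono fun x hx => by
          simp only [Function.mem_support, ne_eq, Pi.pow_apply] at hx ⊢
          intro h0; exact hx (by rw [h0]; ring))
    · exact Eventually.of_forall fun x => by positivity
  have hptw : ∀ x, Tendsto (fun n => ENNReal.ofReal (fn n x ^ 4)) atTop
      (𝓝 (ENNReal.ofReal (f x ^ 4))) := by
    intro x
    refine ENNReal.tendsto_ofReal ?_
    have h := ((tendsto_cutoff_natCast_add_one x).mul_const (f x)).pow 4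
    simpa [hfn] using h
  have hFatou : ∫⁻ x, ENNReal.ofReal (f x ^ 4) ≤ ENNReal.ofReal (1 / 2 * X * D) := by
    calc ∫⁻ x, ENNReal.ofReal (f x ^ 4)
        = ∫⁻ x, liminf (fun n => ENNReal.ofReal (fn n x ^ 4)) atTop :=
          lintegral_congr fun x => ((hptw x).liminf_eq).symm
      _ ≤ liminf (fun n => ∫⁻ x, ENNReal.ofReal (fn n x ^ 4)) atTop :=
          lintegral_liminf_le fun n =>
            ((hfn1 n).continuous.pow 4).measurable.ennreal_ofReal
      _ ≤ liminf (fun n => ENNReal.ofReal (1 / 2 * X * ∫ x, ‖fderiv ℝ (fn n) x‖ ^ 2)) atTop := by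
          refine liminf_le_liminf (Eventually.of_forall fun n => ?_)
          rw [hG n]
          exact ENNReal.ofReal_le_ofReal (hN n)
      _ = ENNReal.ofReal (1 / 2 * X * D) :=
          ((ENNReal.tendsto_ofReal (hlimD.const_mul (1 / 2 * X))).liminf_eq)
  -- conclusions
  have hmeas : AEStronglyMeasurable (fun x => f x ^ 4) volume := (hfc.pow 4).aestronglyMeasurable
  have henorm : ∀ x, ‖f x ^ 4‖ₑ = ENNReal.ofReal (f x ^ 4) := fun x =>
    Real.enorm_eq_ofReal (by positivity)
  have hint : Integrable fun x => f x ^ 4 := by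
    refine ⟨hmeas, ?_⟩
    unfold HasFiniteIntegral
    simp_rw [henorm]
    exact hFatou.trans_lt ENNReal.ofReal_lt_top
  refine ⟨hint, ?_⟩
  rw [integral_eq_lintegral_of_nonneg_ae (Eventually.of_forall fun x => by positivity) hmeas]
  exact ENNReal.toReal_le_of_le_ofReal (by positivity) hFatou

end PlanarSobolev

end Literature.Analysis.FluidPDE
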